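import Summits.NavierStokesRegularity.NavierStokesRegularity.Theorems.OddMorawetzOddMorawetzLocalNullLemmas
import Summits.NavierStokesRegularity.NavierStokesRegularity.Theorems.OddMorawetzOddMorawetzLocalPairingProps
import HarnessLib

/-!
# Crux `OddMorawetzLocal` (stmt-NavierStokesRegularity-1376), refutation: null reduction of the pairing

Stub `morawetzPairing_vecOf_eq_zero` of the refutation skeleton of the crux `OddMorawetzLocal` (line
`registered`, lead c1): the bridge from the kernel certificate shapes of a NULL isotropic basis polynomial to the
vanishing of its Morawetz pairing.

For a divergence-free Schwartz field `v` on `ℝ³` and an integer jet polynomial `q` whose monomials are basis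
monomials of weight `k`, the Morawetz pairing of the coefficient vector `vecOf k q` is
`-∫ lin q (Jv x) (J B(v,v) x) dx` (`lin_polyOfV_vecOf`, the landed part (4) of `pairing_props`).  It vanishes in
the two certified cases:

* `.null` — `q` has the same values as the divergence `div F = D₀F₀ + D₁F₁ + D₂F₂` of an integer flux triple of
  jet order `≤ 3` (the certificate stores the fast normal form of that divergence): equal values give equal
  linearisations (`NullReduction.lin_congr_of_evalA`: both are the `s`-derivative at `0` of the same function
  `s ↦ evalA · (ζ + s η)`, `hasDerivAt_evalA_line`), the coefficient map `ℤ → ℚ → ℝ` commutes with `D i` and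
  `divergence` (`NullReduction.divergence_map`, `NullReduction.cast_map_intCast`), and null lemma 1
  (`integral_lin_divergence_eq_zero`) applies to the rational fluxes `Fᵢ.map (ℤ → ℚ)`;
* `.ideal` — `isZeroF (subst nfVar q) = true` over `ℤ`: the coefficient map `ℤ → ℚ` commutes with `subst nfVar`
  (`NullReduction.subst_map`, `NullReduction.nfVar_intCast`) and with the fast normal form (`JPoly.normF_map`), so
  the rational polynomial `q.map (ℤ → ℚ)` carries the same certificate and null lemma 2 (`lin_eq_zero_of_nfKills`)
  kills the integrand pointwise.

Mathlib plus the landed `null_lemmas` parts, `lin_polyOfV_vecOf`, `hasDerivAt_evalA_line`, `JPoly.normF_map`; no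
definitions, no named facts.
-/

noncomputable section

open MeasureTheory

set_option linter.dupNamespace false
set_option autoImplicit false

namespace Summit.NavierStokesRegularity.NavierStokesRegularity.Theorems.OddMorawetz

namespace NullReduction

/-! ### Equal values give equal linearisations -/

/-- Two real jet polynomials with the same values at every assignment have the same linearisation: `lin p ζ η` is
the derivative at `s = 0` of `s ↦ evalA p (ζ + s • η)` (`hasDerivAt_evalA_line`), and derivatives are unique. -/
theorem lin_congr_of_evalA {p p' : JPoly ℝ} (h : ∀ ξ, JPoly.evalA p ξ = JPoly.evalA p' ξ) (ζ η : JVar → ℝ) :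
    JPoly.lin p ζ η = JPoly.lin p' ζ η := by
  have h₁ := hasDerivAt_evalA_line p ζ η
  have hfun : (fun s : ℝ => JPoly.evalA p (ζ + s • η)) = fun s : ℝ => JPoly.evalA p' (ζ + s • η) :=
    funext fun s => h (ζ + s • η)
  rw [hfun] at h₁
  exact h₁.unique (hasDerivAt_evalA_line p' ζ η)

/-! ### Coefficient maps commute with the jet algebra -/

variable {R S : Type}

/-- A map of the coefficients does not change the monomials, hence preserves jet-order bounds. -/
theorem order_map (φ : R → S) {n : ℕ} (p : JPoly R) (hp : ∀ t ∈ p, ∀ w ∈ t.2, w.2.length ≤ n) :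
    ∀ t ∈ p.map (fun t => (φ t.1, t.2)), ∀ w ∈ t.2, w.2.length ≤ n := by
  intro t ht w hw
  obtain ⟨s, hs, rfl⟩ := List.mem_map.1 ht
  exact hp s hs w hw

/-- The total derivative `D i` commutes with any map of the coefficients (it only rewrites monomials). -/
theorem D_map (φ : R → S) (i : Fin 3) (p : JPoly R) :
    JPoly.D i (p.map fun t => (φ t.1, t.2)) = (JPoly.D i p).map fun t => (φ t.1, t.2) := by
  simp only [JPoly.D, List.flatMap_map, List.map_flatMap, List.map_map, Function.comp_def]

/-- The divergence of a flux triple commutes with any map of the coefficients. -/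
theorem divergence_map (φ : R → S) (F₀ F₁ F₂ : JPoly R) :
    JPoly.divergence (F₀.map fun t => (φ t.1, t.2), F₁.map fun t => (φ t.1, t.2), F₂.map fun t => (φ t.1, t.2)) =
      (JPoly.divergence (F₀, F₁, F₂)).map fun t => (φ t.1, t.2) := by
  simp only [JPoly.divergence, D_map, List.map_append]

/-- The product commutes with a multiplicative map of the coefficients. -/
theorem mul_map [Mul R] [Mul S] (φ : R → S) (hmul : ∀ a b, φ (a * b) = φ a * φ b) (p q : JPoly R) :
    JPoly.mul (p.map fun t => (φ t.1, t.2)) (q.map fun t => (φ t.1, t.2)) =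
      (JPoly.mul p q).map fun t => (φ t.1, t.2) := by
  -- adapted from OddMorawetzOddMorawetzLocalActFunctorial (private `mul_map_ringHom` there)
  simp only [JPoly.mul, List.flatMap_map, List.map_flatMap, List.map_map, Function.comp_def, hmul]

/-- `prodList` of coefficient-mapped factors is the coefficient-mapped `prodList` (unital multiplicative map). -/
theorem prodList_map [Mul R] [One R] [Mul S] [One S] (φ : R → S) (hmul : ∀ a b, φ (a * b) = φ a * φ b)
    (hone : φ 1 = 1) (σ : JVar → JPoly R) (m : List JVar) :
    JPoly.prodList (m.map fun v => (σ v).map fun t => (φ t.1, t.2)) =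
      (JPoly.prodList (m.map σ)).map fun t => (φ t.1, t.2) := by
  -- adapted from OddMorawetzOddMorawetzLocalActFunctorial (private `prodList_map_ringHom` there)
  induction m with
  | nil => simp [JPoly.prodList, hone]
  | cons v m ih => simp only [List.map_cons, JPoly.prodList, ih, mul_map φ hmul]

/-- Substitution commutes with a unital multiplicative map of the coefficients, for compatible substitutions. -/
theorem subst_map [Mul R] [One R] [Mul S] [One S] (φ : R → S) (hmul : ∀ a b, φ (a * b) = φ a * φ b)
    (hone : φ 1 = 1) (σ : JVar → JPoly R) (σ' : JVar → JPoly S) (hσ : ∀ v, ((σ v).map fun t => (φ t.1, t.2)) = σ' v)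
    (p : JPoly R) :
    JPoly.subst σ' (p.map fun t => (φ t.1, t.2)) = (JPoly.subst σ p).map fun t => (φ t.1, t.2) := by
  -- adapted from OddMorawetzOddMorawetzLocalActFunctorial (private `subst_map_ringHom` there)
  have hσ' : σ' = fun v => (σ v).map fun t => (φ t.1, t.2) := funext fun v => (hσ v).symm
  subst hσ'
  simp only [JPoly.subst, List.flatMap_map, List.map_flatMap, List.map_map, Function.comp_def, hmul]
  congr 1
  funext t
  rw [prodList_map φ hmul hone, List.map_map]
  simp only [Function.comp_def]

/-- The rational `nfVar w` is the coefficient image of the integer one (its coefficients are `±1`). -/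
theorem nfVar_intCast (w : JVar) :
    (JPoly.nfVar w : JPoly ℚ) = (JPoly.nfVar w : JPoly ℤ).map fun t => ((t.1 : ℚ), t.2) := by
  unfold JPoly.nfVar
  split_ifs <;> simp

/-- The composite coefficient map `ℤ → ℚ → ℝ` is the direct one. -/
theorem cast_map_intCast (p : JPoly ℤ) :
    JPoly.cast (p.map fun t => ((t.1 : ℚ), t.2)) = p.map fun t => ((t.1 : ℝ), t.2) := by
  simp only [JPoly.cast, List.map_map, Function.comp_def, Rat.cast_intCast]

/-- The integer ideal certificate `isZeroF (subst nfVar q)` transfers to the rational polynomial `q.map (ℤ → ℚ)`. -/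
theorem isZeroF_subst_nfVar_map_intCast (q : JPoly ℤ) (hq : JPoly.isZeroF (JPoly.subst JPoly.nfVar q) = true) :
    JPoly.isZeroF (JPoly.subst JPoly.nfVar (q.map fun t => ((t.1 : ℚ), t.2))) = true := by
  have hnil : JPoly.normF (JPoly.subst JPoly.nfVar q) = [] := List.isEmpty_iff.1 hq
  have hsub : JPoly.subst JPoly.nfVar (q.map fun t => ((t.1 : ℚ), t.2)) =
      (JPoly.subst JPoly.nfVar q).map fun t => ((t.1 : ℚ), t.2) :=
    subst_map (Int.cast : ℤ → ℚ) Int.cast_mul Int.cast_one JPoly.nfVar JPoly.nfVar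
      (fun w => (nfVar_intCast w).symm) q
  simp only [JPoly.isZeroF, hsub, JPoly.normF_map (Int.cast : ℤ → ℚ) Int.cast_add (fun _ => Int.cast_eq_zero),
    hnil, List.map_nil, List.isEmpty_nil]

end NullReduction

/-! ### The registered stub -/

/-- **Stub `morawetzPairing_vecOf_eq_zero` of crux `OddMorawetzLocal`** (refutation skeleton, assembly).  For a
divergence-free Schwartz field `v` on `ℝ³` and an integer jet polynomial `q` on the weight-`k` basis, the
Morawetz pairing of the coefficient vector `vecOf k q` vanishes as soon as `q` is NULL in one of the two certified
senses: (`.null`) `q` has the values of the divergence of an integer flux triple of jet order `≤ 3`, or (`.ideal`)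
the kernel certifies `isZeroF (subst nfVar q) = true` (the divergence-free normal form of `q` is zero).  The pairing
is `-∫ lin q (Jv)(J B(v,v))` (`lin_polyOfV_vecOf`); in the first case `lin q = lin (div F)` pointwise
(`NullReduction.lin_congr_of_evalA`) and null lemma 1 applies to the rational fluxes; in the second the rational
polynomial `q` carries the same certificate (`NullReduction.isZeroF_subst_nfVar_map_intCast`) and null lemma 2
kills the integrand. -/
theorem morawetzPairing_vecOf_eq_zero (k : ℕ) (v : EuclideanSpace ℝ (Fin 3) → EuclideanSpace ℝ (Fin 3))
    (hv : Literature.Analysis.FluidPDE.IsSchwartzField v) (hd : Literature.Analysis.FluidPDE.VectorCalculus.IsDivFree v)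
    (q : JPoly ℤ) (hq : ∀ t ∈ q, t.2 ∈ idx k) (hpw : q.Pairwise fun s t => s.2 ≠ t.2)
    (hnull : (∃ F₀ F₁ F₂ : JPoly ℤ, (∀ F ∈ [F₀, F₁, F₂], ∀ t ∈ F, ∀ u ∈ t.2, u.2.length ≤ 3) ∧
        ∀ ξ : JVar → ℝ, JPoly.evalA (q.map fun t => ((t.1 : ℝ), t.2)) ξ =
          JPoly.evalA ((JPoly.divergence (F₀, F₁, F₂)).map fun t => ((t.1 : ℝ), t.2)) ξ) ∨
      JPoly.isZeroF (JPoly.subst JPoly.nfVar q) = true) :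
    morawetzPairing k v (fun i => ((vecOf k q i : ℤ) : ℝ)) = 0 := by
  -- the distinctness of the monomials of `q` is not needed: `lin_polyOfV_vecOf` regroups any basis polynomial
  have _ := hpw
  unfold morawetzPairing
  rw [neg_eq_zero]
  simp only [lin_polyOfV_vecOf k q hq]
  rcases hnull with ⟨F₀, F₁, F₂, hF, hev⟩ | hid
  · -- `.null`: `lin q = lin (div F)` pointwise, and the divergence of the rational fluxes pairs to zero
    have hdiv : (JPoly.divergence (F₀, F₁, F₂)).map (fun t => ((t.1 : ℝ), t.2)) =
        JPoly.cast (JPoly.divergence (F₀.map fun t => ((t.1 : ℚ), t.2), F₁.map fun t => ((t.1 : ℚ), t.2),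
          F₂.map fun t => ((t.1 : ℚ), t.2))) := by
      rw [NullReduction.divergence_map, NullReduction.cast_map_intCast]
    have hl : ∀ ζ η : JVar → ℝ, JPoly.lin (q.map fun t => ((t.1 : ℝ), t.2)) ζ η =
        JPoly.lin (JPoly.cast (JPoly.divergence (F₀.map fun t => ((t.1 : ℚ), t.2),
          F₁.map fun t => ((t.1 : ℚ), t.2), F₂.map fun t => ((t.1 : ℚ), t.2)))) ζ η := by
      intro ζ η
      rw [← hdiv]
      exact NullReduction.lin_congr_of_evalA hev ζ η
    simp only [hl]
    refine integral_lin_divergence_eq_zero v hv hd _ _ _ ?_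
    intro F hFm
    simp only [List.mem_cons, List.not_mem_nil, or_false] at hFm
    rcases hFm with rfl | rfl | rfl
    · exact NullReduction.order_map (Int.cast : ℤ → ℚ) F₀ (hF F₀ (by simp))
    · exact NullReduction.order_map (Int.cast : ℤ → ℚ) F₁ (hF F₁ (by simp))
    · exact NullReduction.order_map (Int.cast : ℤ → ℚ) F₂ (hF F₂ (by simp))
  · -- `.ideal`: the integrand vanishes at every point
    have hz : ∀ x, JPoly.lin (q.map fun t => ((t.1 : ℝ), t.2)) (jetVal v x)
        (jetVal (Literature.Analysis.FluidPDE.eulerBilinear v v) x) = 0 := by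
      intro x
      rw [← NullReduction.cast_map_intCast]
      exact lin_eq_zero_of_nfKills v hv hd _ (NullReduction.isZeroF_subst_nfVar_map_intCast q hid) x
    simp only [hz, integral_zero]

end Summit.NavierStokesRegularity.NavierStokesRegularity.Theorems.OddMorawetz

end
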